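import Summits.RiemannHypothesis.RiemannHypothesis.Theorems.PfPersistenceLocalityBarrier

/-!
# PF-persistence fake seat 6 — the `q = 1` coordinate of `dialSpace` IS the spectral shift

mechanism/rigidity campaign; no RH claims.  PROVED statements only (no `sorry`, no new axioms).

`WP L w Θ = 2 Σ_{q ∈ primeRange L} w q · Θ(log q)` sums over `primeRange L = range (⌊e^L⌋₊ + 1)`, which contains
`q = 1` (and `q = 0`) for every `L ≥ 0`, placed at position `Real.log 1 = 0`; and `θ_{nm}(0) = δ_{nm}` (Connes' basis is
orthonormal).  Hence adding `c` to the weight at `q = 1` — a move INSIDE `dialSpace = Set.range datumOf`, since `Weights`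
is every table `ℕ → ℝ` — subtracts `2c · 1` from EVERY window matrix: the tree's self-planted SHIFT family
`shift (2c) (datumOf w)` of `PfPersistenceLocalityBarrier` (there typed over the full operator domain) lies in `dialSpace`.

Consequences recorded here (all PROVED):
* `datumOf_shiftWeights` : `datumOf (shiftWeights w c) win = datumOf w win − (2c) • 1`;
* `mulVec_eigen_iff_shift` : the shifted table has the SAME eigenvectors at every window, eigenvalues moved by `−2c`;
* `windowNegative_shift` / `exists_shift_detectablyNegative` : it is negative at a window as soon as `2c` exceeds one
  Rayleigh quotient of `w` there (e.g. the `(0,0)` entry);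
* `shiftInvariant_unsound` : NO predicate of a window matrix that is invariant under `M ↦ M − t • 1` (every functional of
  the eigenvector frame alone: sign patterns, nodal counts, central mass, profile fields, `E₁(A₀) = u₁ᵀ A₀ u₁`, entry
  ratios of `u₁`, …) holds at `ζ`'s window matrix without also holding at a NEGATIVE member of `dialSpace` at the SAME
  window — uniformly in `(a, N)`, with the explicit witness `ζ + c·𝟙_{q=1}`;
* `negativesAccumulateNe_dialSpace_of_galerkinInfZero` : uniform accumulation of dial-space negatives at `ζ` follows from
  the Galerkin upper law ALONE (the companion file needed the TYPED prime-dial input `DialReady` for the dial space).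
Whether the campaign wants `q ∈ {0, 1}` inside the arithmetic dial space is a TYPING decision for the adjudicators
(ADJ-LOG A35): as typed today it is.
-/

set_option linter.dupNamespace false  -- the mandated namespace repeats `RiemannHypothesis`

namespace Summit.RiemannHypothesis.RiemannHypothesis.Theorems.PfPersistence.F6Shift

open Summit.RiemannHypothesis.RiemannHypothesis.Theorems.PfPersistence Matrix Finset

/-- add `c` to the weight carried at `q = 1` (position `log 1 = 0`). [folklore] -/
def shiftWeights (w : Weights) (c : ℝ) : Weights := fun q => if q = 1 then w q + c else w q

/-- PROVED: pointwise difference of the shifted and the original table: `c` at `q = 1`, `0` elsewhere. [folklore] -/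
theorem shiftWeights_sub (w : Weights) (c : ℝ) (q : ℕ) :
    shiftWeights w c q - w q = if q = 1 then c else 0 := by
  unfold shiftWeights; split_ifs <;> ring

/-- PROVED: `1 ∈ primeRange L` for `L ≥ 0`. [folklore] -/
theorem one_mem_primeRange {L : ℝ} (hL : 0 ≤ L) : 1 ∈ primeRange L := by
  unfold primeRange
  rw [Finset.mem_range]
  have h1 : (1 : ℝ) ≤ Real.exp L := by
    have := Real.add_one_le_exp L
    linarith
  have h2 : 1 ≤ ⌊Real.exp L⌋₊ := by
    rw [Nat.one_le_floor_iff]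
    exact h1
  omega

/-- PROVED: `θ_{nm}(0) = δ_{nm}` (orthonormality of Connes' even basis), `L ≠ 0`. [folklore] -/
theorem thetaEven_zero (L : ℝ) (hL : L ≠ 0) (n m : ℕ) :
    thetaEven L n m 0 = if n = m then 1 else 0 := by
  unfold thetaEven
  by_cases hn : n = 0 <;> by_cases hm : m = 0 <;> by_cases hnm : n = m <;> simp_all

/-- PROVED: the prime part after the shift: `WP L (shiftWeights w c) Θ = WP L w Θ + 2 c Θ(0)`. [folklore] -/
theorem WP_shiftWeights {L : ℝ} (hL : 0 ≤ L) (w : Weights) (c : ℝ) (Θ : ℝ → ℝ) :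
    WP L (shiftWeights w c) Θ = WP L w Θ + 2 * c * Θ 0 := by
  unfold WP
  have hsub : ∑ q ∈ primeRange L, shiftWeights w c q * Θ (Real.log q)
      - ∑ q ∈ primeRange L, w q * Θ (Real.log q) = c * Θ 0 := by
    rw [← Finset.sum_sub_distrib]
    have : ∀ q ∈ primeRange L, shiftWeights w c q * Θ (Real.log q) - w q * Θ (Real.log q)
        = if q = 1 then c * Θ 0 else 0 := by
      intro q _
      rw [← sub_mul, shiftWeights_sub]
      split_ifs with h
      · subst h; simp
      · simp
    rw [Finset.sum_congr rfl this, Finset.sum_ite_eq' (primeRange L) 1 (fun _ => c * Θ 0)]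
    simp [one_mem_primeRange hL]
  linarith

/-- **PROVED**: the window matrix of the shifted table is the old one minus `2c · 1` — the `q = 1` coordinate of
`dialSpace` is the SPECTRAL SHIFT of every window block. [folklore] -/
theorem evenBlock_shiftWeights (w : Weights) (c : ℝ) (win : Window) :
    evenBlock (shiftWeights w c) win = evenBlock w win - (2 * c) • (1 : Matrix _ _ ℝ) := by
  ext n m
  have hL : 0 ≤ 2 * win.a := by have := win.ha; positivity
  have hL' : 2 * win.a ≠ 0 := by have := win.ha; positivity
  simp only [evenBlock, weil, Matrix.sub_apply, Matrix.smul_apply, Matrix.one_apply, smul_eq_mul]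
  rw [WP_shiftWeights hL, thetaEven_zero _ hL']
  by_cases h : n = m
  · subst h; simp; ring
  · have h' : (n : ℕ) ≠ (m : ℕ) := fun e => h (Fin.ext e)
    simp [h, h']

/-- PROVED: the shifted table's datum, window by window. [folklore] -/
theorem datumOf_shiftWeights (w : Weights) (c : ℝ) (win : Window) :
    datumOf (shiftWeights w c) win = datumOf w win - (2 * c) • (1 : Matrix _ _ ℝ) :=
  evenBlock_shiftWeights w c win

/-- PROVED: the shifted datum lies in `dialSpace` (it IS a weight table). [folklore] -/
theorem datumOf_shiftWeights_mem (w : Weights) (c : ℝ) : datumOf (shiftWeights w c) ∈ dialSpace := ⟨_, rfl⟩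

/-- PROVED: every Rayleigh quotient drops by exactly `2c |v|²`. [folklore] -/
theorem rayleigh_shiftWeights (w : Weights) (c : ℝ) (win : Window) (v : Fin (win.N + 1) → ℝ) :
    v ⬝ᵥ (evenBlock (shiftWeights w c) win *ᵥ v) = v ⬝ᵥ (evenBlock w win *ᵥ v) - 2 * c * (v ⬝ᵥ v) := by
  rw [evenBlock_shiftWeights]
  simp only [Matrix.sub_mulVec, dotProduct_sub, Matrix.smul_mulVec, Matrix.one_mulVec, dotProduct_smul,
    smul_eq_mul]

/-- **PROVED (same eigenvectors)**: `v` is an eigenvector of the window matrix of `w` with eigenvalue `ε` iff it is an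
eigenvector of the shifted table's window matrix with eigenvalue `ε − 2c`.  Every functional of the eigenvector FRAME
(and of the ORDER of the eigenvalues) is blind to the shift. [folklore] -/
theorem mulVec_eigen_iff_shift (w : Weights) (c ε : ℝ) (win : Window) (v : Fin (win.N + 1) → ℝ) :
    evenBlock w win *ᵥ v = ε • v ↔ evenBlock (shiftWeights w c) win *ᵥ v = (ε - 2 * c) • v := by
  rw [evenBlock_shiftWeights, Matrix.sub_mulVec, Matrix.smul_mulVec, Matrix.one_mulVec, sub_smul]
  constructor
  · intro h; rw [h]
  · intro h; exact sub_left_injective h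

/-- PROVED: the shifted table is NEGATIVE at a window as soon as `2c |v|²` exceeds one Rayleigh value of `w` there. [folklore] -/
theorem windowNegative_shift {w : Weights} {c : ℝ} {win : Window} (v : Fin (win.N + 1) → ℝ)
    (hv : v ⬝ᵥ (evenBlock w win *ᵥ v) < 2 * c * (v ⬝ᵥ v)) :
    v ⬝ᵥ (evenBlock (shiftWeights w c) win *ᵥ v) < 0 := by
  rw [rayleigh_shiftWeights]; linarith

/-- PROVED: the first basis vector has unit square norm. [folklore] -/
theorem single_zero_dot_self {n : ℕ} : (Pi.single 0 1 : Fin (n + 1) → ℝ) ⬝ᵥ Pi.single 0 1 = 1 := by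
  simp [dotProduct, Pi.single_apply]

/-- PROVED: every table has a `q = 1` shift that is negative at any prescribed window. [folklore] -/
theorem exists_shift_negative_at (w : Weights) (win : Window) :
    ∃ c : ℝ, ∃ v : Fin (win.N + 1) → ℝ, v ⬝ᵥ (evenBlock (shiftWeights w c) win *ᵥ v) < 0 := by
  refine ⟨(evenBlock w win 0 0 + 1) / 2, Pi.single 0 1, windowNegative_shift _ ?_⟩
  rw [single_zero_rayleigh, single_zero_dot_self]
  linarith

/-- **PROVED (closure of every eigenvector-only leaf, uniformly in the window)**: a predicate of one window matrix that is
SHIFT-INVARIANT (`K M → K (M − t • 1)`: every functional of the eigenvector frame alone) and holds at `ζ`'s matrix of a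
window ALSO holds at the matrix of a member of `dialSpace` that is NEGATIVE AT THAT SAME WINDOW.  So no shift-invariant
single-window criterion is sound on `dialSpace` at any window, whatever its resolution. [folklore] -/
theorem shiftInvariant_unsound {K : ∀ {n : ℕ}, Matrix (Fin n) (Fin n) ℝ → Prop}
    (hK : ∀ {n : ℕ} (M : Matrix (Fin n) (Fin n) ℝ) (t : ℝ), K M → K (M - t • (1 : Matrix (Fin n) (Fin n) ℝ)))
    (win : Window) (hζ : K (zetaDatum win)) :
    ∃ d ∈ dialSpace, K (d win) ∧ ∃ v : Fin (win.N + 1) → ℝ, v ⬝ᵥ (d win *ᵥ v) < 0 := by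
  obtain ⟨c, v, hv⟩ := exists_shift_negative_at zetaWeights win
  refine ⟨datumOf (shiftWeights zetaWeights c), datumOf_shiftWeights_mem _ _, ?_, v, hv⟩
  rw [datumOf_shiftWeights]
  exact hK _ _ hζ

/-- PROVED: the same with `DetectablyNegative` (the campaign's negativity notion). [folklore] -/
theorem shiftInvariant_unsound' {K : ∀ {n : ℕ}, Matrix (Fin n) (Fin n) ℝ → Prop}
    (hK : ∀ {n : ℕ} (M : Matrix (Fin n) (Fin n) ℝ) (t : ℝ), K M → K (M - t • (1 : Matrix (Fin n) (Fin n) ℝ)))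
    (win : Window) (hζ : K (zetaDatum win)) :
    ∃ d ∈ dialSpace, K (d win) ∧ DetectablyNegative d := by
  obtain ⟨d, hd, hK', v, hv⟩ := shiftInvariant_unsound hK win hζ
  exact ⟨d, hd, hK', win, v, hv⟩

/-- PROVED: `ζ` carries no weight at `q = 1` (`Λ(1) = 0`). [folklore] -/
theorem zetaWeights_one : zetaWeights 1 = 0 := by
  simp [zetaWeights, ArithmeticFunction.vonMangoldt_apply_one]

/-- PROVED: the shifted `ζ` table differs from `ζ`'s datum for `c ≠ 0` (the `(0,0)` entry of any window moves by `2c`). [folklore] -/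
theorem datumOf_shift_zeta_ne {c : ℝ} (hc : c ≠ 0) : datumOf (shiftWeights zetaWeights c) ≠ zetaDatum := by
  intro h
  have h00 := congrArg (fun e : Datum => e ⟨1, 0, one_pos⟩ 0 0) h
  simp only [zetaDatum] at h00
  rw [datumOf_shiftWeights] at h00
  simp only [Matrix.sub_apply, Matrix.smul_apply, Matrix.one_apply_eq, smul_eq_mul, mul_one] at h00
  exact hc (by linarith)


/-- PROVED: the companion file's abstract spectral-shift family `shift δ` (typed there over `Set.univ`) lies INSIDE `dialSpace`:
`shift (2c) (datumOf w) = datumOf (shiftWeights w c)`. [folklore] -/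
theorem shift_datumOf (w : Weights) (c : ℝ) : shift (2 * c) (datumOf w) = datumOf (shiftWeights w c) := by
  funext win
  rw [shift, datumOf_shiftWeights]

/-- PROVED: hence `shift δ zetaDatum ∈ dialSpace` for every `δ`. [folklore] -/
theorem shift_zetaDatum_mem_dialSpace (δ : ℝ) : shift δ zetaDatum ∈ dialSpace := by
  have h : shift δ zetaDatum = datumOf (shiftWeights zetaWeights (δ / 2)) := by
    rw [← shift_datumOf]; congr 1; ring
  rw [h]; exact ⟨_, rfl⟩

/-- PROVED: the shift by `c ≥ 0` is uniformly `2c`-close to the original datum. [folklore] -/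
theorem uniformlyClose_shiftWeights (w : Weights) {c : ℝ} (hc : 0 ≤ c) :
    UniformlyClose (2 * c) (datumOf w) (datumOf (shiftWeights w c)) := by
  intro win v
  have h : datumOf w win - datumOf (shiftWeights w c) win = (2 * c) • (1 : Matrix _ _ ℝ) := by
    rw [datumOf_shiftWeights]; simp
  rw [h, Matrix.smul_mulVec, Matrix.one_mulVec, dotProduct_smul, smul_eq_mul,
    abs_of_nonneg (mul_nonneg (by positivity) (dotProduct_self_nonneg_real v))]

/-- **PROVED (dial-space accumulation from the Galerkin upper law ALONE)**: if `ζ`'s Galerkin bottom tends to zero,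
negatives of `dialSpace` other than `ζ` accumulate uniformly at `ζ` — the witnesses are the `q = 1` shifts.  (The companion
file proves this over the full operator domain and needs the TYPED prime-dial input `DialReady` for the dial space.) [folklore] -/
theorem negativesAccumulateNe_dialSpace_of_galerkinInfZero (h : GalerkinInfZero zetaDatum) :
    NegativesAccumulateNe dialSpace zetaDatum := by
  intro ε hε
  obtain ⟨win, v, hv⟩ := h ε hε
  refine ⟨datumOf (shiftWeights zetaWeights (ε / 2)), datumOf_shiftWeights_mem _ _,
    datumOf_shift_zeta_ne (by positivity), ⟨win, v, ?_⟩, ?_⟩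
  · show v ⬝ᵥ (evenBlock (shiftWeights zetaWeights (ε / 2)) win *ᵥ v) < 0
    rw [rayleigh_shiftWeights]
    have h1 : v ⬝ᵥ (evenBlock zetaWeights win *ᵥ v) = v ⬝ᵥ (zetaDatum win *ᵥ v) := rfl
    have h2 : 2 * (ε / 2) * (v ⬝ᵥ v) = ε * (v ⬝ᵥ v) := by ring
    linarith
  · have hclose := uniformlyClose_shiftWeights zetaWeights (c := ε / 2) (by positivity)
    have e : 2 * (ε / 2) = ε := by ring
    rw [e] at hclose
    exact hclose

/-! ## Extremality: at every window the `q = 1` shifts realise the distance from a window matrix to the negative cone -/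

/-- PROVED (lower bound, any datum whatsoever): if every Rayleigh quotient of `M` is `≥ ε |v|²` and `M'` is negative on `v`,
then `M − M'` has Rayleigh value `> ε |v|²` on that same `v` — no negative matrix is quadratically closer to `M` than `ε`. [folklore] -/
theorem rayleigh_gap_of_negative {k : ℕ} {M M' : Matrix (Fin k) (Fin k) ℝ} {ε : ℝ}
    (hM : ∀ v : Fin k → ℝ, ε * (v ⬝ᵥ v) ≤ v ⬝ᵥ (M *ᵥ v)) {v : Fin k → ℝ} (hv : v ⬝ᵥ (M' *ᵥ v) < 0) :
    ε * (v ⬝ᵥ v) < v ⬝ᵥ ((M - M') *ᵥ v) := by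
  have := hM v
  rw [Matrix.sub_mulVec, dotProduct_sub]
  linarith

/-- PROVED (upper bound, inside `dialSpace`): the shift by `c` is quadratically EXACTLY `2c`-far from the original at every window and
every `v`; with `2c = ε + η` (`η > 0` arbitrary) it is negative wherever a Rayleigh quotient `< (ε + η)|v|²` exists.  Together with
`rayleigh_gap_of_negative`: the window-wise quadratic distance from `datumOf w win` to the members of `dialSpace` negative at `win`
is the bottom Rayleigh value of `w` at `win` itself — the dial space (as typed) is as close to the negative cone as any operator can be. [folklore] -/
theorem rayleigh_datumOf_sub_shift (w : Weights) (c : ℝ) (win : Window) (v : Fin (win.N + 1) → ℝ) :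
    v ⬝ᵥ ((datumOf w win - datumOf (shiftWeights w c) win) *ᵥ v) = 2 * c * (v ⬝ᵥ v) := by
  have h : datumOf w win - datumOf (shiftWeights w c) win = (2 * c) • (1 : Matrix _ _ ℝ) := by
    rw [datumOf_shiftWeights]; simp
  rw [h, Matrix.smul_mulVec, Matrix.one_mulVec, dotProduct_smul, smul_eq_mul]

end Summit.RiemannHypothesis.RiemannHypothesis.Theorems.PfPersistence.F6Shift
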